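import Summits.QuantumFields.BalabanUV.T4Continuum.Support.ShellMeasureVandermondeSUN
import Summits.QuantumFields.BalabanUV.T4Continuum.Support.ShellMeasureExpChartSUN
import Summits.QuantumFields.BalabanUV.T4Continuum.Support.ShellMeasureScalingSU2

/-!
# `T4Continuum.ShellMeasureExpJacobianSUN` — the ROOT-SPACE JACOBIAN of the exponential chart of `SU(N)` as a
# MEASURABLE function of the chart point, `J(v) = ∏_{i<j} sinc²((θ_i−θ_j)/2)` off the non-regular cone, and its
# monotonicity towards the centre on `‖v‖ ≤ π`
# (cell `pub-balaban`, sub-cell `t4`, spine estimate NE7c (node U5b); ROUND-2 crew `t4-ne7c-formalise-*`, row S3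
# «SM-L9 SU(N) chart» of `t4/b2b-balaban-t4-ne7c-p1/LEAVES-NE7c-P1.md` (trigger `t4/T4-NE7c-TRIGGER.json`, c5:
# optional and last); seat `b2b-balaban-t4-ne7c-formalise-leaf-04`; file 4 of the row; tree target
# `Summits/QuantumFields/BalabanUV/T4Continuum/Support/`; ADDITIVE — imports `ShellMeasureVandermondeSUN` (the two
# Gram determinants), `ShellMeasureExpChartSUN` (the chart: `genSU`, `coordSU`, `norm_genSU`) and
# `ShellMeasureScalingSU2` (the `sinc` monotonicity `sinc_le_sinc_of_le_of_le_pi`, by name) and modifies nothing)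

HONEST FRAMING.  Finite four-torus programme, rung (B)+1 only — NOT infinite volume, NOT a mass gap, NOT the Clay
problem, NOT summit progress.  Nothing of [Balaban 1983–89] is mentioned or asserted; NE7c NOT proved and not touched
(spine PROVED 0/9).  [folklore] linear algebra and trigonometry, 0 sorry, 0 citations, no `def … : Prop`.  What this
file discharges is a BINDER of `ShellMeasureScalingSUN.slotAntiConcentration_realized_suN_of_coreMap` (the
centre-monotonicity `hJ₁c` and measurability of the one-bond chart weight) for the EXPLICIT exponential Haar Jacobian;
the chart identity (CH)₁ itself stays displayed there.

THE POINTS.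
* §1 THE PAIR IDENTITY `|e^{iα} − e^{iβ}|² = (α−β)²·sinc²((α−β)/2)` (`normSq_cexp_sub_cexp`).
* §2 THE HERMITIAN GENERATOR `H(v) = −i·genSU v` of the chart point (`herm`, `isHermitian_herm`), its unitary
  diagonalisation `H(v) = U·diag θ·U*` (Mathlib's spectral theorem; `exists_conjDiag`), `genSU v = i·H(v)`, the chart
  point `exp (genSU v) = U·diag(e^{iθ_k})·U*` (`exp_genSU_eq_conjDiag`), and the eigenvalue bound `θ_k² ≤ ‖v‖²`
  (`sq_eigen_le_norm_sq`: `Σ θ_k² = tr H² = ‖genSU v‖²_HS = ‖v‖²`).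
* §3 THE JACOBIAN `expJacSU v := Re udisc(exp genSU v) / Re disc(H(v))` — a quotient of the two Gram determinants of
  `ShellMeasureVandermondeSUN`, hence MEASURABLE in `v` (`measurable_expJacSU`) with no eigenvalue map; under any
  unitary diagonalisation with `∏_{i<j}(θ_j−θ_i) ≠ 0` (regular generator) it EQUALS the root-space product
  `∏_{i<j} sinc²((θ_j−θ_i)/2)` (`expJacSU_eq_prod_sinc`), it vanishes on the non-regular cone (`expJacSU_eq_zero`, a
  closed Lebesgue-null cone — irrelevant for a density), and `0 ≤ expJacSU ≤ 1` (`expJacSU_nonneg`, `expJacSU_le_one`).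
* §4 CENTRE-MONOTONICITY: for `‖v‖ ≤ π` and `0 < c ≤ 1`, `expJacSU v ≤ expJacSU (c • v)` (`expJacSU_le_smul`) — every
  gap `|θ_j−θ_i|/2 ≤ π` lies where `sinc` is non-increasing (`ShellMeasureScalingSU2.sinc_le_sinc_of_le_of_le_pi`) and the
  eigenvalues of `c • v` are `c·θ` for the SAME `U`.  §5 packages `κ·expJacSU` (`κ` = the normalising constant of
  (CH)₁, left free) as the one-bond chart weight `expJacWeightSU κ : E_N → ℝ≥0∞`: measurable and centre-monotone on
  every ball of radius `S ≤ π` — LITERALLY the binders `hJ₁`, `hJ₁c` of the `SU(N)` realized headline.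

WHAT THIS DOES NOT DO.  The MEASURE identity (CH)₁ — «Haar of `SU(N)` on `exp(B̄_S)` is `expPtSU_*(volume|_{B̄_S}·
κ·expJacSU)`» — is NOT proved here (NOT in Mathlib for `N ≥ 3`); NE7c NOT proved.
-/

noncomputable section

namespace Summit.QuantumFields.BalabanUV.T4Continuum.ShellMeasureExpJacobianSUN

open Matrix Finset MeasureTheory
open scoped ComplexConjugate ENNReal
open Complex (I normSq)
open Literature.MathematicalPhysics.QuantumFieldTheory.Balaban1983to89
open T4AdjointCovarianceUnitary (lieSU mem_lieSU_iff exp_conj_unitary)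
open ShellMeasureVandermondeSUN ShellMeasureExpChartSUN

variable {N : ℕ}

/-! ## §1 The pair identity -/

section Pair

/-- `sinc` is even: `sinc |x| = sinc x`. [folklore] -/
theorem sinc_abs (x : ℝ) : Real.sinc |x| = Real.sinc x := by
  rcases abs_choice x with h | h
  · rw [h]
  · rw [h, Real.sinc_neg]

/-- `4 sin²(δ/2) = δ²·sinc²(δ/2)`. [folklore] -/
theorem four_mul_sin_sq_half (δ : ℝ) : 4 * Real.sin (δ / 2) ^ 2 = δ ^ 2 * Real.sinc (δ / 2) ^ 2 := by
  by_cases hδ : δ = 0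
  · rw [hδ, zero_div, Real.sin_zero]; ring
  · have h2 : δ / 2 ≠ 0 := div_ne_zero hδ two_ne_zero
    rw [Real.sinc_of_ne_zero h2]
    field_simp
    ring

/-- `2 − 2 cos δ = δ²·sinc²(δ/2)`. [folklore] -/
theorem two_sub_two_mul_cos (δ : ℝ) : 2 - 2 * Real.cos δ = δ ^ 2 * Real.sinc (δ / 2) ^ 2 := by
  rw [← four_mul_sin_sq_half]
  have h := Real.cos_two_mul (δ / 2)
  rw [mul_div_cancel₀ δ two_ne_zero] at h
  nlinarith [Real.sin_sq_add_cos_sq (δ / 2)]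

/-- **THE PAIR IDENTITY** `|e^{iα} − e^{iβ}|² = (α−β)²·sinc²((α−β)/2)`. [folklore] -/
theorem normSq_cexp_sub_cexp (α β : ℝ) :
    normSq (Complex.exp (α * I) - Complex.exp (β * I)) = (α - β) ^ 2 * Real.sinc ((α - β) / 2) ^ 2 := by
  rw [Complex.normSq_sub, Complex.normSq_eq_norm_sq, Complex.normSq_eq_norm_sq, Complex.norm_exp_ofReal_mul_I,
    Complex.norm_exp_ofReal_mul_I, ← Complex.exp_conj, map_mul, Complex.conj_ofReal, Complex.conj_I,
    ← Complex.exp_add]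
  have h : (α : ℂ) * I + (β : ℂ) * -I = ((α - β : ℝ) : ℂ) * I := by push_cast; ring
  rw [h, Complex.exp_ofReal_mul_I_re, ← two_sub_two_mul_cos]
  ring

end Pair

/-! ## §2 The Hermitian generator of the chart point and its unitary diagonalisation -/

section Herm

/-- THE HERMITIAN GENERATOR `H(v) = −i · genSU v` (real spectrum `θ`; `genSU v = i·H(v)`). [folklore] -/
def herm (v : ChartSU N) : Matrix (Fin N) (Fin N) ℂ := (-I) • genSU v

/-- `H(v)` is Hermitian. [folklore] -/
theorem isHermitian_herm (v : ChartSU N) : (herm v).IsHermitian := by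
  unfold herm
  rw [IsHermitian, conjTranspose_smul, ← star_eq_conjTranspose, (genSU_mem v).1, star_neg, Complex.star_def,
    Complex.conj_I, neg_neg, smul_neg, ← neg_smul]

/-- `genSU v = i · H(v)`. [folklore] -/
theorem genSU_eq_I_smul_herm (v : ChartSU N) : genSU v = I • herm v := by
  unfold herm
  rw [smul_smul, mul_neg, Complex.I_mul_I, neg_neg, one_smul]

/-- `H(c • v) = c · H(v)`. [folklore] -/
theorem herm_smul (c : ℝ) (v : ChartSU N) : herm (c • v) = (c : ℂ) • herm v := by
  unfold herm
  rw [genSU_smul, smul_comm]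

/-- `H` is continuous in the chart point. [folklore] -/
theorem continuous_herm : Continuous (herm (N := N)) := by
  show Continuous fun v : ChartSU N => (-I) • genSU v
  exact continuous_genSU.const_smul (-I)

/-- **UNITARY DIAGONALISATION** of the Hermitian generator (Mathlib's spectral theorem): `H(v) = U·diag θ·U*` with
`θ` real. [folklore] -/
theorem exists_conjDiag (v : ChartSU N) :
    ∃ (U : Matrix.unitaryGroup (Fin N) ℂ) (θ : Fin N → ℝ), herm v = conjDiag U fun k => (θ k : ℂ) := by
  refine ⟨(isHermitian_herm v).eigenvectorUnitary, (isHermitian_herm v).eigenvalues, ?_⟩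
  have h := (isHermitian_herm v).spectral_theorem
  rw [Unitary.conjStarAlgAut_apply] at h
  exact h

variable {v : ChartSU N} {U : Matrix.unitaryGroup (Fin N) ℂ} {θ : Fin N → ℝ}

/-- under a diagonalisation of `H(v)`, `H(c • v) = U·diag(cθ)·U*` with the SAME `U`. [folklore] -/
theorem herm_smul_eq_conjDiag (h : herm v = conjDiag U fun k => (θ k : ℂ)) (c : ℝ) :
    herm (c • v) = conjDiag U fun k => ((c * θ k : ℝ) : ℂ) := by
  rw [herm_smul, h, smul_conjDiag]
  congr 1
  funext k
  rw [Pi.smul_apply, smul_eq_mul, Complex.ofReal_mul]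

/-- under a diagonalisation of `H(v)`, THE CHART POINT IS `exp (genSU v) = U·diag(e^{iθ_k})·U*`. [folklore] -/
theorem exp_genSU_eq_conjDiag (h : herm v = conjDiag U fun k => (θ k : ℂ)) :
    NormedSpace.exp (genSU v) = conjDiag U fun k => Complex.exp (θ k * I) := by
  have hd : NormedSpace.exp (I • fun k => (θ k : ℂ)) = fun k => Complex.exp (θ k * I) := by
    funext k
    rw [Pi.coe_exp, Pi.smul_apply, smul_eq_mul, congr_fun Complex.exp_eq_exp_ℂ ((θ k : ℂ) * I), mul_comm]
  rw [genSU_eq_I_smul_herm, h, smul_conjDiag]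
  unfold conjDiag
  rw [exp_conj_unitary, Matrix.exp_diagonal, hd]

open scoped Matrix.Norms.Frobenius in
/-- the Hilbert–Schmidt norm of the chart generator is the sum of the squared eigenvalues:
`‖v‖² = ‖genSU v‖²_HS = tr H(v)² = Σ_k θ_k²`. [folklore] -/
theorem norm_sq_eq_sum_sq (h : herm v = conjDiag U fun k => (θ k : ℂ)) : ‖v‖ ^ 2 = ∑ k, θ k ^ 2 := by
  have h1 : ‖v‖ = ‖genSU v‖ := by rw [← norm_genSU v, Submodule.coe_norm]; rfl
  have h2 : (genSU v)ᴴ * genSU v = herm v ^ 2 := by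
    rw [genSU_eq_I_smul_herm, conjTranspose_smul, (isHermitian_herm v).eq, Matrix.smul_mul, Matrix.mul_smul,
      smul_smul, Complex.star_def, Complex.conj_I, neg_mul, Complex.I_mul_I, neg_neg, one_smul, sq]
  rw [h1, Matrix.frobenius_norm_sq_eq_re_trace, h2, h, trace_conjDiag_pow, RCLike.re_to_complex, Complex.re_sum]
  refine sum_congr rfl fun k _ => ?_
  rw [← Complex.ofReal_pow, Complex.ofReal_re]

/-- **EIGENVALUE BOUND**: every eigenvalue of `H(v)` has `θ_k² ≤ ‖v‖²`, so `|θ_k| ≤ ‖v‖`. [folklore] -/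
theorem abs_eigen_le_norm (h : herm v = conjDiag U fun k => (θ k : ℂ)) (k : Fin N) : |θ k| ≤ ‖v‖ := by
  have hsq : θ k ^ 2 ≤ ‖v‖ ^ 2 := by
    rw [norm_sq_eq_sum_sq h]
    exact single_le_sum (f := fun k => θ k ^ 2) (fun i _ => sq_nonneg (θ i)) (mem_univ k)
  exact abs_le_of_sq_le_sq' hsq (norm_nonneg v) |>.elim (fun h1 h2 => abs_le.mpr ⟨h1, h2⟩)

end Herm

/-! ## §3 The Jacobian: a determinant formula, measurable, equal to `∏ sinc²` off the non-regular cone -/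

section Jacobian

/-- **THE EXPONENTIAL HAAR JACOBIAN OF `SU(N)` IN THE CHART** (up to the normalising constant of (CH)₁): the quotient
of the unitary discriminant of the chart point by the discriminant of the Hermitian generator,
`Re det[tr (g^a (g*)^b)] / Re det[tr H^{a+b}]`, `g = exp (genSU v)`, `H = −i·genSU v` — by §3 below this IS
`∏_{i<j} sinc²((θ_i−θ_j)/2)` wherever the generator is regular, and `0` on the (null) non-regular cone. [folklore] -/
def expJacSU (v : ChartSU N) : ℝ := (udisc (NormedSpace.exp (genSU v))).re / (disc (herm v)).re

/-- the Jacobian is MEASURABLE in the chart point (a quotient of continuous functions). [folklore] -/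
theorem measurable_expJacSU : Measurable (expJacSU (N := N)) := by
  have hexp : Continuous fun v : ChartSU N => NormedSpace.exp (genSU v) := by
    open scoped Matrix.Norms.L2Operator in
    letI : NormedAlgebra ℚ (Matrix (Fin N) (Fin N) ℂ) := NormedAlgebra.restrictScalars ℚ ℂ _
    exact NormedSpace.exp_continuous.comp continuous_genSU
  exact (Complex.continuous_re.comp (continuous_udisc.comp hexp)).measurable.div
    (Complex.continuous_re.comp (continuous_disc.comp continuous_herm)).measurable

variable {v : ChartSU N} {U : Matrix.unitaryGroup (Fin N) ℂ} {θ : Fin N → ℝ}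

/-- **THE ROOT-SPACE FORMULA**: under a unitary diagonalisation `H(v) = U·diag θ·U*` with REGULAR `θ`
(`∏_{i<j}(θ_j−θ_i) ≠ 0`), `expJacSU v = ∏_{i<j} sinc²((θ_j−θ_i)/2)`. [folklore] -/
theorem expJacSU_eq_prod_sinc (h : herm v = conjDiag U fun k => (θ k : ℂ))
    (hreg : ∏ i : Fin N, ∏ j ∈ Ioi i, (θ j - θ i) ≠ 0) :
    expJacSU v = ∏ i : Fin N, ∏ j ∈ Ioi i, Real.sinc ((θ j - θ i) / 2) ^ 2 := by
  have hreg2 : ∏ i : Fin N, ∏ j ∈ Ioi i, (θ j - θ i) ^ 2 ≠ 0 :=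
    prod_ne_zero_iff.mpr fun i hi => prod_ne_zero_iff.mpr fun j hj =>
      pow_ne_zero 2 (prod_ne_zero_iff.mp (prod_ne_zero_iff.mp hreg i hi) j hj)
  unfold expJacSU
  rw [exp_genSU_eq_conjDiag h, udisc_conjDiag_re, h, disc_conjDiag_re]
  simp_rw [normSq_cexp_sub_cexp, prod_mul_distrib, ← prod_pow]
  exact mul_div_cancel_left₀ _ hreg2

/-- on the NON-REGULAR cone the determinant formula gives `0`. [folklore] -/
theorem expJacSU_eq_zero (h : herm v = conjDiag U fun k => (θ k : ℂ))
    (hreg : ∏ i : Fin N, ∏ j ∈ Ioi i, (θ j - θ i) = 0) : expJacSU v = 0 := by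
  unfold expJacSU
  rw [h, disc_conjDiag_re, hreg, zero_pow two_ne_zero, div_zero]

/-- `0 ≤ expJacSU v`. [folklore] -/
theorem expJacSU_nonneg (v : ChartSU N) : 0 ≤ expJacSU v := by
  obtain ⟨U, θ, h⟩ := exists_conjDiag v
  by_cases hreg : ∏ i : Fin N, ∏ j ∈ Ioi i, (θ j - θ i) = 0
  · rw [expJacSU_eq_zero h hreg]
  · rw [expJacSU_eq_prod_sinc h hreg]
    exact prod_nonneg fun i _ => prod_nonneg fun j _ => sq_nonneg _

/-- `expJacSU v ≤ 1` (`|sinc| ≤ 1`). [folklore] -/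
theorem expJacSU_le_one (v : ChartSU N) : expJacSU v ≤ 1 := by
  obtain ⟨U, θ, h⟩ := exists_conjDiag v
  by_cases hreg : ∏ i : Fin N, ∏ j ∈ Ioi i, (θ j - θ i) = 0
  · rw [expJacSU_eq_zero h hreg]; exact zero_le_one
  · rw [expJacSU_eq_prod_sinc h hreg]
    refine prod_le_one (fun i _ => prod_nonneg fun j _ => sq_nonneg _) fun i _ => ?_
    refine prod_le_one (fun j _ => sq_nonneg _) fun j _ => ?_
    rw [sq_le_one_iff_abs_le_one]
    exact Real.abs_sinc_le_one _

end Jacobian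

/-! ## §4 Centre-monotonicity on `‖v‖ ≤ π` -/

section Monotone

variable {v : ChartSU N} {U : Matrix.unitaryGroup (Fin N) ℂ} {θ : Fin N → ℝ}

/-- one pair: for `|δ| ≤ 2π` and `0 < c ≤ 1`, `sinc²(δ/2) ≤ sinc²(cδ/2)`. [folklore] -/
theorem sinc_sq_half_le_smul {δ : ℝ} (hδ : |δ| ≤ 2 * Real.pi) {c : ℝ} (hc0 : 0 < c) (hc1 : c ≤ 1) :
    Real.sinc (δ / 2) ^ 2 ≤ Real.sinc (c * δ / 2) ^ 2 := by
  rw [← sinc_abs (δ / 2), ← sinc_abs (c * δ / 2), abs_div, abs_div, abs_mul, abs_of_pos hc0, abs_two]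
  have hr : 0 ≤ c * |δ| / 2 := by positivity
  have hrr' : c * |δ| / 2 ≤ |δ| / 2 := by nlinarith [abs_nonneg δ]
  have hr' : |δ| / 2 ≤ Real.pi := by linarith
  obtain ⟨h0, hle⟩ := ShellMeasureScalingSU2.sinc_le_sinc_of_le_of_le_pi hr hrr' hr'
  exact pow_le_pow_left₀ h0 hle 2

/-- regularity is scale-invariant: `∏_{i<j}(cθ_j − cθ_i) ≠ 0` for `c ≠ 0`. [folklore] -/
theorem prod_sub_smul_ne_zero (hreg : ∏ i : Fin N, ∏ j ∈ Ioi i, (θ j - θ i) ≠ 0) {c : ℝ} (hc : c ≠ 0) :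
    ∏ i : Fin N, ∏ j ∈ Ioi i, (c * θ j - c * θ i) ≠ 0 := by
  simp_rw [← mul_sub, prod_mul_distrib, prod_const]
  exact mul_ne_zero (prod_ne_zero_iff.mpr fun i _ => pow_ne_zero _ hc) hreg

/-- **CENTRE-MONOTONICITY OF THE EXPONENTIAL HAAR JACOBIAN**: for `‖v‖ ≤ π` and `0 < c ≤ 1`,
`expJacSU v ≤ expJacSU (c • v)` — the Jacobian does not decrease towards the centre of the chart along positive
contractions, so it rides free in (S-ii). [folklore] -/
theorem expJacSU_le_smul (hv : ‖v‖ ≤ Real.pi) {c : ℝ} (hc0 : 0 < c) (hc1 : c ≤ 1) :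
    expJacSU v ≤ expJacSU (c • v) := by
  obtain ⟨U, θ, h⟩ := exists_conjDiag v
  have hc := herm_smul_eq_conjDiag h c
  by_cases hreg : ∏ i : Fin N, ∏ j ∈ Ioi i, (θ j - θ i) = 0
  · rw [expJacSU_eq_zero h hreg]
    exact expJacSU_nonneg _
  · rw [expJacSU_eq_prod_sinc h hreg, expJacSU_eq_prod_sinc hc (prod_sub_smul_ne_zero hreg hc0.ne')]
    refine prod_le_prod (fun i _ => prod_nonneg fun j _ => sq_nonneg _) fun i _ => ?_
    refine prod_le_prod (fun j _ => sq_nonneg _) fun j _ => ?_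
    rw [← mul_sub, mul_div_assoc, ← mul_div_assoc]
    refine sinc_sq_half_le_smul ?_ hc0 hc1
    calc |θ j - θ i| ≤ |θ j| + |θ i| := abs_sub _ _
      _ ≤ Real.pi + Real.pi := add_le_add ((abs_eigen_le_norm h j).trans hv) ((abs_eigen_le_norm h i).trans hv)
      _ = 2 * Real.pi := by ring

end Monotone

/-! ## §5 The one-bond chart weight `κ · expJacSU`: the binders `hJ₁`, `hJ₁c` of the `SU(N)` realized headline -/

section Weight

/-- THE ONE-BOND CHART WEIGHT `J₁ = κ · expJacSU` (`κ` = the normalising constant of the chart identity (CH)₁, left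
free). [folklore] -/
def expJacWeightSU (κ : ℝ≥0∞) (v : ChartSU N) : ℝ≥0∞ := κ * ENNReal.ofReal (expJacSU v)

/-- `J₁` is measurable — the binder `hJ₁`. [folklore] -/
theorem measurable_expJacWeightSU (κ : ℝ≥0∞) : Measurable (expJacWeightSU (N := N) κ) :=
  (ENNReal.measurable_ofReal.comp measurable_expJacSU).const_mul κ

/-- `J₁ ≤ κ`. [folklore] -/
theorem expJacWeightSU_le (κ : ℝ≥0∞) (v : ChartSU N) : expJacWeightSU κ v ≤ κ := by
  unfold expJacWeightSU
  calc κ * ENNReal.ofReal (expJacSU v) ≤ κ * 1 :=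
        mul_le_mul' le_rfl (ENNReal.ofReal_le_one.mpr (expJacSU_le_one v))
    _ = κ := mul_one κ

/-- **`J₁` DOES NOT DECREASE TOWARDS THE CENTRE on every ball of radius `S ≤ π` along positive contractions** —
LITERALLY the binder `hJ₁c` of `ShellMeasureScalingSUN.slotAntiConcentration_realized_suN_of_coreMap`. [folklore] -/
theorem expJacWeightSU_le_smul (κ : ℝ≥0∞) {S : ℝ} (hS : S ≤ Real.pi) :
    ∀ v : ChartSU N, ‖v‖ ≤ S → ∀ c : ℝ, 0 < c → c ≤ 1 → expJacWeightSU κ v ≤ expJacWeightSU κ (c • v) :=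
  fun _ hv _ hc0 hc1 =>
    mul_le_mul' le_rfl (ENNReal.ofReal_le_ofReal (expJacSU_le_smul (hv.trans hS) hc0 hc1))

end Weight

end Summit.QuantumFields.BalabanUV.T4Continuum.ShellMeasureExpJacobianSUN

end
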